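import Summits.BirchSwinnertonDyer.BirchSwinnertonDyer.Theorems.EisensteinPrimesBSDpOnCellCTelescopeBranchTwistCharacter
import Summits.BirchSwinnertonDyer.BirchSwinnertonDyer.Theorems.EisensteinPrimesBSDpOnCellCTelescopeBranchConjDescent
import Literature.NumberTheory.EllipticCurves.PNewBranchGaloisLattice
import Literature.NumberTheory.EllipticCurves.BSDConductorProofs
import Literature.NumberTheory.GaloisRepresentations.FramedRepTwist
import HarnessLib

/-!
# [telescope — width x2-p2 g24, 2026-08-30] `IsBranchGaloisLattice` FROM AN UNTWISTED LATTICE: a framed continuous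
# `ρ' : Γ_ℚ →ₜ* GL₂(ℤ_p⟦X⟧)` whose member fibres are Deligne's representations `(D t).Δ.ρ` of the members (Hida 1986 Thm. 2.1 (2.2c)
# VERBATIM: «`π mod P_f` is equivalent to `π(f)`»), twisted by the critical character `Θ` of `…TelescopeBranchTwistCharacter`, IS a lattice
# with the member fibres in the critical twist `(D t).Δ.selfDualRep` that T-An-2ᵍ's Galois clause asks for — transcription step (D8), flag
# `TG-twist`, DISCHARGED as a tree theorem (and, with `…TelescopeBranchConjDescent`, step (D5) at the same time: fibres may be read over `Ω = ℚ̄_p`)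
# Crux 4 `BSDpOnCellC` (stmt-BirchSwinnertonDyer-19034), line «telescope» (`--supports`, helper; closes nothing)

WHY: after telescope v17 the ONE load-bearing named fact of the line is the assembled T-An-2ᵍ
`Literature.NumberTheory.EllipticCurves.hida1986_castella2020_exists_galoisLattice_on_pNewBranchChart`; its Galois clause `IsBranchGaloisLattice`
states the member fibres in the CRITICAL TWIST and over the residue fields `ℚ_p` / `K_t`, which print reaches only through the transcription
steps (D5) (descent of conjugacy) and (D8) (the twist `Θ(σ) = exp(−(p^M/2)·log⟨ε(σ)⟩·X)`). THIS FILE proves: clauses (U-unr) = (G-unr),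
(U-fib₀) = (G-fib₀), (U-rat) = (G-rat) and the UNTWISTED member clause (U-fib_t) «`ρ' σ = C(M σ) + (X − C x_t)·U σ` with `M` conjugate to
`(D t).Δ.ρ`» for SOME framed `ρ'`, on chart data with (pts)/(wt)/(memb) and `p ∣ N`, `p ≠ 2`, IMPLY `∃ ρ, IsBranchGaloisLattice W p x D ρ`
(`ρ = ρ' ⊗ Θ`): **`exists_isBranchGaloisLattice_of_untwisted`** (conjugacies over `ℚ_p` / `K_t`) and
**`exists_isBranchGaloisLattice_of_untwisted_conjOver`** (conjugacies over any field `Ω ⊇ ℚ̄_p`-style overfield, e.g. `PadicAlgCl p`, via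
`TelescopeBranchConjDescent`). So a de-assembled re-typing of T-An-2ᵍ may carry Hida's (2.2b)/(2.2c) token for token (untwisted, over `Ω`)
and the tree supplies the rest.

CONTENT (namespace `…Theorems.TelescopeBranchLatticeOfUntwisted`; THEOREMS ONLY): §1 plumbing (`not_mem_asIdeal_of_dvd_of_not_dvd`, `exists_matrix_eq_map_evalHom_add`, scalar
lemmas for `Matrix.map`, the value `selfDualTwistChar ι σ = ε(σ)^{1−k/2}` read in an overfield); §2 `twist_member_conj` (the member
conjugacy after twisting, over a general `Ω`); §3 the existence theorems (+ a form with member fibres as specialisations `(ρ' σ).map (evalHom x_t)`, and one reading (pts)/(wt)/(memb) off `IsPNewBranchAnalyticChart`).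

HONEST FRAMING: composition of landed bricks over binders; constructs no Galois lattice from a modular form (the untwisted `ρ'` is a
HYPOTHESIS — Hida's theorem); closes no registered stub, no crux, no summit statement; BSD is proved for no curve by this file. No named fact,
no definition, no instance, no `sorry`.
References (shape only): [cite: Hida1986, Thm. 2.1 (2.2b) (2.2c) (p. 559)] [cite: Howard2007BigHeegner, Def. 2.1.3 (critical twist)]
-/

set_option autoImplicit false
set_option linter.dupNamespace false

noncomputable section

open scoped Classical MatrixGroups PowerSeries.WithPiTopology
open PowerSeries IsDedekindDomain NumberField
open Literature.NumberTheory.EllipticCurves Literature.NumberTheory.EllipticCurves.GreenbergSelmer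
  Literature.NumberTheory.EllipticCurves.ModularForms Literature.NumberTheory.GaloisRepresentations
  Summit.BirchSwinnertonDyer.BirchSwinnertonDyer.Theorems.TelescopeBranchTwistExpSeries
  Summit.BirchSwinnertonDyer.BirchSwinnertonDyer.Theorems.TelescopeBranchTwistCharacter
  Summit.BirchSwinnertonDyer.BirchSwinnertonDyer.Theorems.TelescopeBranchConjDescent

namespace Summit.BirchSwinnertonDyer.BirchSwinnertonDyer.Theorems.TelescopeBranchLatticeOfUntwisted

variable {p : ℕ} [hp : Fact p.Prime]

/-! ### §1. Plumbing -/

/-- If `p ∣ N` and the prime `ℓ_v` under the place `v` of `ℚ` does not divide `N`, then `v ∤ p`. [folklore] -/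
theorem not_mem_asIdeal_of_dvd_of_not_dvd {N : ℕ} (hpN : p ∣ N) {v : HeightOneSpectrum (𝓞 ℚ)}
    (hv : ¬ ((Rat.HeightOneSpectrum.primesEquiv v : Nat.Primes) : ℕ) ∣ N) : ((p : ℕ) : 𝓞 ℚ) ∉ v.asIdeal := by
  intro h
  apply hv
  have hv' := (natCast_mem_asIdeal_iff_eq_primesEquiv_symm v hp.out).mp h
  rw [hv', Equiv.apply_symm_apply]
  exact hpN

/-- `(a • A).map f = f a • A.map f` for a multiplicative map `f`. [folklore] -/
theorem map_smul_of_map_mul {m R S : Type*} [Mul R] [Mul S] (f : R → S) (hf : ∀ a b, f (a * b) = f a * f b) (a : R)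
    (A : Matrix m m R) : (a • A).map f = f a • A.map f := by
  ext i j
  simp only [Matrix.map_apply, Matrix.smul_apply, smul_eq_mul, hf]

/-- **Matrix Weierstrass remainder at a point of the open disc**: every `F ∈ M_n(ℤ_p⟦X⟧)` is `C(F(c)) + (X − C c)·U` with
`F(c) = F.map (evalHom c)` (entrywise `TelescopeBranchTwistExpSeries.exists_eq_C_evalHom_add_X_sub_C_mul`). [cite: Washington1997, §7.1 Prop. 7.2] -/
theorem exists_matrix_eq_map_evalHom_add {n : Type*} [Fintype n] (F : Matrix n n (PowerSeries ℤ_[p])) {c : ℤ_[p]} (hc : ‖c‖ < 1) :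
    ∃ U : Matrix n n (PowerSeries ℤ_[p]),
      F = (F.map (evalHom c hc)).map (PowerSeries.C (R := ℤ_[p])) + (PowerSeries.X - PowerSeries.C c) • U := by
  have h := fun i j => exists_eq_C_evalHom_add_X_sub_C_mul (F i j) hc
  choose u hu using h
  refine ⟨Matrix.of fun i j => u i j, Matrix.ext fun i j => ?_⟩
  simp only [Matrix.add_apply, Matrix.map_apply, Matrix.smul_apply, Matrix.of_apply, smul_eq_mul]
  exact hu i j

/-- Evaluation at `σ` commutes with integer powers in the group of continuous characters `G →ₜ* Aˣ`. [folklore] -/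
theorem continuousMonoidHom_zpow_apply {G A : Type*} [Group G] [TopologicalSpace G] [CommGroup A] [TopologicalSpace A]
    [IsTopologicalGroup A] (χ : G →ₜ* A) (z : ℤ) (σ : G) : (χ ^ z) σ = χ σ ^ z := by
  let ev : (G →ₜ* A) →* A := { toFun := fun ψ => ψ σ, map_one' := rfl, map_mul' := fun _ _ => rfl }
  exact map_zpow ev χ z

section Member

variable {M' : ℕ} {k' : ℤ} {g' : CuspForm (CongruenceSubgroup.Gamma0 M') k'} {ι' : coeffField g' →+* PadicAlgCl p}

/-- The `𝒪`-valued cyclotomic character is the `ℤ_p`-valued one pushed along `ℤ_p → 𝒪` (units form of the tree's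
`padicCoeffIntegers.coe_cyclotomicCharacter_apply`). [folklore] -/
theorem cyclotomicCharacter_padicCoeffIntegers_eq_map (σ : Field.absoluteGaloisGroup ℚ) :
    padicCoeffIntegers.cyclotomicCharacter ι' σ =
      Units.map (algebraMap ℤ_[p] (padicCoeffIntegers ι')).toMonoidHom (GaloisRep.cyclotomicCharacter ℚ p σ) :=
  Units.ext (by rw [padicCoeffIntegers.coe_cyclotomicCharacter_apply, Units.coe_map, RingHom.toMonoidHom_eq_coe, MonoidHom.coe_coe])

/-- **The value of the self-dual twisting character read in an overfield**: for `Ω ⊇ K_t ⊇ ℚ_p`,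
`(selfDualTwistChar ι σ : Ω) = (ε(σ)^{1 − k/2} : Ω)` with `ε = GaloisRep.cyclotomicCharacter ℚ p` (integer power in `ℤ_pˣ`). [folklore] -/
theorem algebraMap_selfDualTwistChar (Ω : Type*) [Field Ω] [Algebra ℚ_[p] Ω] [Algebra (padicCoeffField ι') Ω]
    [IsScalarTower ℚ_[p] (padicCoeffField ι') Ω] (σ : Field.absoluteGaloisGroup ℚ) :
    algebraMap (padicCoeffField ι') Ω (((selfDualTwistChar ι' σ : (padicCoeffIntegers ι')ˣ) : padicCoeffIntegers ι') : padicCoeffField ι') =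
      algebraMap ℚ_[p] Ω ((((GaloisRep.cyclotomicCharacter ℚ p σ ^ (1 - k' / 2) : ℤ_[p]ˣ)) : ℤ_[p]) : ℚ_[p]) := by
  rw [selfDualTwistChar_def, continuousMonoidHom_zpow_apply, cyclotomicCharacter_padicCoeffIntegers_eq_map, ← map_zpow, Units.coe_map,
    RingHom.toMonoidHom_eq_coe, MonoidHom.coe_coe, padicCoeffIntegers.algebraMap_padicInt_eq, padicCoeffIntegers.coe_ofPadicInt,
    ← IsScalarTower.algebraMap_apply]

/-- **The member conjugacy after twisting** (over any field `Ω ⊇ K_t ⊇ ℚ_p`): if the `ℤ_p`-matrices `M σ` are conjugate over `Ω` to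
Deligne's `Δ.ρ σ` (`M^Ω = P · (Δ.ρ)^Ω · P⁻¹`), then `θ_σ • M σ` with `θ_σ = ε(σ)^{1−k/2}` are conjugate over `Ω`, by the SAME `P`, to the
self-dual twist `Δ.selfDualRep σ = ε(σ)^{1−k/2} • Δ.ρ σ`. [cite: Hida1986, Thm. 2.1 (2.2c)] [cite: Castella2018Erratum, §2 (the self-dual twist)] -/
theorem twist_member_conj (Δ : OrdinaryNewformDatum g' p ι') (Ω : Type*) [Field Ω] [Algebra ℚ_[p] Ω] [Algebra (padicCoeffField ι') Ω]
    [IsScalarTower ℚ_[p] (padicCoeffField ι') Ω]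
    (M : Field.absoluteGaloisGroup ℚ → Matrix (Fin 2) (Fin 2) ℤ_[p]) (θ : Field.absoluteGaloisGroup ℚ → ℤ_[p])
    (hθ : ∀ σ, θ σ = (((GaloisRep.cyclotomicCharacter ℚ p σ ^ (1 - k' / 2) : ℤ_[p]ˣ)) : ℤ_[p])) (P : GL (Fin 2) Ω)
    (h : ∀ σ : Field.absoluteGaloisGroup ℚ,
      (M σ).map (fun z : ℤ_[p] => algebraMap ℚ_[p] Ω (z : ℚ_[p])) =
        ((P : GL (Fin 2) Ω) : Matrix (Fin 2) (Fin 2) Ω) *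
          (((Δ.ρ σ : GL (Fin 2) (padicCoeffIntegers ι')) : Matrix (Fin 2) (Fin 2) (padicCoeffIntegers ι')).map
            (fun z : padicCoeffIntegers ι' => algebraMap (padicCoeffField ι') Ω (z : padicCoeffField ι'))) *
          ((P⁻¹ : GL (Fin 2) Ω) : Matrix (Fin 2) (Fin 2) Ω)) (σ : Field.absoluteGaloisGroup ℚ) :
    (θ σ • M σ).map (fun z : ℤ_[p] => algebraMap ℚ_[p] Ω (z : ℚ_[p])) =
      ((P : GL (Fin 2) Ω) : Matrix (Fin 2) (Fin 2) Ω) *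
        (((Δ.selfDualRep σ : GL (Fin 2) (padicCoeffIntegers ι')) : Matrix (Fin 2) (Fin 2) (padicCoeffIntegers ι')).map
          (fun z : padicCoeffIntegers ι' => algebraMap (padicCoeffField ι') Ω (z : padicCoeffField ι'))) *
        ((P⁻¹ : GL (Fin 2) Ω) : Matrix (Fin 2) (Fin 2) Ω) := by
  rw [map_smul_of_map_mul _ (fun a b => by simp only [PadicInt.coe_mul, map_mul]), h σ, OrdinaryNewformDatum.coe_selfDualRep_apply,
    map_smul_of_map_mul _ (fun a b => by simp only [Subring.coe_mul, map_mul]), Matrix.mul_smul, Matrix.smul_mul,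
    algebraMap_selfDualTwistChar Ω σ, hθ σ]

end Member

/-! ### §2. The existence theorems -/

set_option maxHeartbeats 1600000 in
/-- **`IsBranchGaloisLattice` from an untwisted lattice.** Let `p ≠ 2`, `p ∣ N = conductor`, chart data `(x, D)` with (pts) `‖x_t‖ < 1`,
(wt) `p^M x_t = k_t − 2`, (memb) `2(p−1) ∣ k_t − 2`, and a framed continuous `ρ' : Γ_ℚ →ₜ* GL₂(ℤ_p⟦X⟧)` with: (U-unr) unramified at every
`v ∤ N`; (U-fib₀) `X = 0` fibre conjugate over `ℚ_p` to `T_pE`; (U-fib_t) for every `t`, `ρ' σ = C(M σ) + (X − C x_t)·U σ` with `M`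
conjugate over `K_t` to Deligne's UNTWISTED `(D t).Δ.ρ` [Hida 1986 (2.2c) verbatim]; (U-rat). THEN `∃ ρ, IsBranchGaloisLattice W p x D ρ`
— namely `ρ = ρ' ⊗ Θ` with the critical twist character `Θ` of `TelescopeBranchTwistCharacter.exists_twistCharacter`.
[cite: Hida1986, Thm. 2.1 (2.2b) (2.2c) (p. 559)] [cite: Howard2007BigHeegner, Def. 2.1.3] -/
theorem exists_isBranchGaloisLattice_of_untwisted (W : WeierstrassCurve ℚ) [W.IsElliptic] [W.IsGloballyMinimal] (hp2 : p ≠ 2)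
    (hpN : p ∣ W.conductorNorm ℤ) (x : ℕ → ℤ_[p]) (D : ℕ → Skinner2016.HidaCongruentForm W p 1)
    (hx : ∀ t, ‖x t‖ < 1) (hwt : ∃ M : ℕ, ∀ t, ((p : ℤ_[p]) ^ M) * x t = (((D t).k - 2 : ℤ) : ℤ_[p]))
    (hmemb : ∀ t, 2 * ((p : ℤ) - 1) ∣ (D t).k - 2)
    (ρ' : FramedGaloisRep ℚ (PowerSeries ℤ_[p]) 2)
    (hunr : ∀ v : HeightOneSpectrum (𝓞 ℚ),
      ¬ ((Rat.HeightOneSpectrum.primesEquiv v : Nat.Primes) : ℕ) ∣ W.conductorNorm ℤ → ρ'.IsUnramifiedAt v)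
    (hfib0 : ∃ (b : Module.Basis (Fin 2) ℤ_[p] (W.tateModule p)) (P : GL (Fin 2) ℚ_[p]),
      ∀ σ : Field.absoluteGaloisGroup ℚ,
        (((ρ' σ : GL (Fin 2) (PowerSeries ℤ_[p])) : Matrix (Fin 2) (Fin 2) (PowerSeries ℤ_[p])).map
            (fun F : PowerSeries ℤ_[p] => ((PowerSeries.constantCoeff F : ℤ_[p]) : ℚ_[p]))) =
          ((P : GL (Fin 2) ℚ_[p]) : Matrix (Fin 2) (Fin 2) ℚ_[p]) *
            (LinearMap.toMatrix b b (W.galoisRepTate p σ)).map (fun z : ℤ_[p] => (z : ℚ_[p])) *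
            ((P⁻¹ : GL (Fin 2) ℚ_[p]) : Matrix (Fin 2) (Fin 2) ℚ_[p]))
    (hfibt : ∀ t : ℕ, ∃ (M : Field.absoluteGaloisGroup ℚ → Matrix (Fin 2) (Fin 2) ℤ_[p])
        (U : Field.absoluteGaloisGroup ℚ → Matrix (Fin 2) (Fin 2) (PowerSeries ℤ_[p]))
        (P : GL (Fin 2) (padicCoeffField (D t).ι)),
      ∀ σ : Field.absoluteGaloisGroup ℚ,
        (((ρ' σ : GL (Fin 2) (PowerSeries ℤ_[p])) : Matrix (Fin 2) (Fin 2) (PowerSeries ℤ_[p])) =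
          (M σ).map (PowerSeries.C (R := ℤ_[p])) + (PowerSeries.X - PowerSeries.C (x t)) • U σ) ∧
        (M σ).map (fun z : ℤ_[p] => algebraMap ℚ_[p] (padicCoeffField (D t).ι) (z : ℚ_[p])) =
          ((P : GL (Fin 2) (padicCoeffField (D t).ι)) : Matrix (Fin 2) (Fin 2) (padicCoeffField (D t).ι)) *
            ((((D t).Δ.ρ σ : GL (Fin 2) (padicCoeffIntegers (D t).ι)) :
                Matrix (Fin 2) (Fin 2) (padicCoeffIntegers (D t).ι)).map
              (fun z : padicCoeffIntegers (D t).ι => (z : padicCoeffField (D t).ι))) *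
            ((P⁻¹ : GL (Fin 2) (padicCoeffField (D t).ι)) : Matrix (Fin 2) (Fin 2) (padicCoeffField (D t).ι)))
    (hrat : ∀ t : ℕ, Function.Surjective (algebraMap ℤ_[p] (padicCoeffIntegers (D t).ι))) :
    ∃ ρ : FramedGaloisRep ℚ (PowerSeries ℤ_[p]) 2, IsBranchGaloisLattice W p x D ρ := by
  obtain ⟨Mw, hwt⟩ := hwt
  obtain ⟨Θ, h0, hev, -, hin⟩ := exists_twistCharacter hp2 Mw hx (k := fun t => (D t).k) hwt hmemb
  refine ⟨FramedRep.twist ρ' Θ, ?_, ?_, fun t => ?_, hrat⟩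
  · -- (G-unr): `Θ` is trivial on inertia at `v ∤ p`, and `v ∤ N ⇒ v ∤ p`
    intro v hv 𝔓 h𝔓 σ hσ
    rw [FramedRep.twist_apply, hin v (not_mem_asIdeal_of_dvd_of_not_dvd hpN hv) 𝔓 h𝔓 σ hσ, map_one, one_mul]
    exact hunr v hv 𝔓 h𝔓 σ hσ
  · -- (G-fib₀): `Θ(σ) ≡ 1 (mod X)`
    obtain ⟨b, P, h⟩ := hfib0
    refine ⟨b, P, fun σ => ?_⟩
    rw [← h σ, FramedRep.coe_twist_apply]
    apply Matrix.ext
    intro i j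
    simp only [Matrix.map_apply, Matrix.smul_apply, smul_eq_mul, map_mul, h0 σ, one_mul]
  · -- (G-fib_t): Weierstrass remainder of `Θ(σ)` at `x_t` and the member conjugacy after twisting
    obtain ⟨M, U, P, h⟩ := hfibt t
    have hrem := fun σ : Field.absoluteGaloisGroup ℚ =>
      exists_eq_C_evalHom_add_X_sub_C_mul (((Θ σ : (PowerSeries ℤ_[p])ˣ)) : PowerSeries ℤ_[p]) (hx t)
    choose V hV using hrem
    refine ⟨fun σ => evalHom (x t) (hx t) (((Θ σ : (PowerSeries ℤ_[p])ˣ)) : PowerSeries ℤ_[p]) • M σ,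
      fun σ => V σ • (M σ).map (PowerSeries.C (R := ℤ_[p])) +
        (PowerSeries.C (evalHom (x t) (hx t) (((Θ σ : (PowerSeries ℤ_[p])ˣ)) : PowerSeries ℤ_[p])) +
          (PowerSeries.X - PowerSeries.C (x t)) * V σ) • U σ,
      P, fun σ => ⟨?_, ?_⟩⟩
    · rw [FramedRep.coe_twist_apply, (h σ).1]
      conv_lhs => rw [hV σ]
      apply Matrix.ext
      intro i j
      simp only [Matrix.smul_apply, Matrix.add_apply, Matrix.map_apply, smul_eq_mul, map_mul]
      ring
    · have hid : (fun z : padicCoeffIntegers (D t).ι => (z : padicCoeffField (D t).ι)) =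
          fun z : padicCoeffIntegers (D t).ι => algebraMap (padicCoeffField (D t).ι) (padicCoeffField (D t).ι) (z : padicCoeffField (D t).ι) := by
        funext z
        rw [Algebra.algebraMap_self, RingHom.id_apply]
      rw [hid] at h ⊢
      exact twist_member_conj (D t).Δ (padicCoeffField (D t).ι) M _ (fun σ => hev t σ) P (fun σ => (h σ).2) σ

set_option maxHeartbeats 1600000 in
/-- **`IsBranchGaloisLattice` from an untwisted lattice READ OVER AN OVERFIELD `Ω`** (e.g. `Ω = ℚ̄_p = PadicAlgCl p`, Hida's coefficient
field in «equivalent as a Galois representation into `GL₂(Ω)`»): as `exists_isBranchGaloisLattice_of_untwisted`, but with the conjugating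
matrices of (U-fib₀) and (U-fib_t) in `GL₂(Ω)`; the descent to `ℚ_p` / `K_t` is `TelescopeBranchConjDescent` (no irreducibility needed).
Steps (D5) and (D8) of T-An-2ᵍ's transcription, jointly discharged. [cite: Hida1986, §2 Terminology (p. 558), Thm. 2.1 (2.2b) (2.2c) (p. 559)] -/
theorem exists_isBranchGaloisLattice_of_untwisted_conjOver (W : WeierstrassCurve ℚ) [W.IsElliptic] [W.IsGloballyMinimal] (hp2 : p ≠ 2)
    (hpN : p ∣ W.conductorNorm ℤ) (x : ℕ → ℤ_[p]) (D : ℕ → Skinner2016.HidaCongruentForm W p 1)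
    (hx : ∀ t, ‖x t‖ < 1) (hwt : ∃ M : ℕ, ∀ t, ((p : ℤ_[p]) ^ M) * x t = (((D t).k - 2 : ℤ) : ℤ_[p]))
    (hmemb : ∀ t, 2 * ((p : ℤ) - 1) ∣ (D t).k - 2)
    (Ω : Type*) [Field Ω] [Algebra ℚ_[p] Ω] [∀ t : ℕ, Algebra (padicCoeffField (D t).ι) Ω]
    [∀ t : ℕ, IsScalarTower ℚ_[p] (padicCoeffField (D t).ι) Ω]
    (ρ' : FramedGaloisRep ℚ (PowerSeries ℤ_[p]) 2)
    (hunr : ∀ v : HeightOneSpectrum (𝓞 ℚ),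
      ¬ ((Rat.HeightOneSpectrum.primesEquiv v : Nat.Primes) : ℕ) ∣ W.conductorNorm ℤ → ρ'.IsUnramifiedAt v)
    (hfib0 : ∃ (b : Module.Basis (Fin 2) ℤ_[p] (W.tateModule p)) (P : GL (Fin 2) Ω),
      ∀ σ : Field.absoluteGaloisGroup ℚ,
        (((ρ' σ : GL (Fin 2) (PowerSeries ℤ_[p])) : Matrix (Fin 2) (Fin 2) (PowerSeries ℤ_[p])).map
            (fun F : PowerSeries ℤ_[p] => algebraMap ℚ_[p] Ω ((PowerSeries.constantCoeff F : ℤ_[p]) : ℚ_[p]))) =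
          ((P : GL (Fin 2) Ω) : Matrix (Fin 2) (Fin 2) Ω) *
            (LinearMap.toMatrix b b (W.galoisRepTate p σ)).map (fun z : ℤ_[p] => algebraMap ℚ_[p] Ω (z : ℚ_[p])) *
            ((P⁻¹ : GL (Fin 2) Ω) : Matrix (Fin 2) (Fin 2) Ω))
    (hfibt : ∀ t : ℕ, ∃ (M : Field.absoluteGaloisGroup ℚ → Matrix (Fin 2) (Fin 2) ℤ_[p])
        (U : Field.absoluteGaloisGroup ℚ → Matrix (Fin 2) (Fin 2) (PowerSeries ℤ_[p])) (P : GL (Fin 2) Ω),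
      ∀ σ : Field.absoluteGaloisGroup ℚ,
        (((ρ' σ : GL (Fin 2) (PowerSeries ℤ_[p])) : Matrix (Fin 2) (Fin 2) (PowerSeries ℤ_[p])) =
          (M σ).map (PowerSeries.C (R := ℤ_[p])) + (PowerSeries.X - PowerSeries.C (x t)) • U σ) ∧
        (M σ).map (fun z : ℤ_[p] => algebraMap ℚ_[p] Ω (z : ℚ_[p])) =
          ((P : GL (Fin 2) Ω) : Matrix (Fin 2) (Fin 2) Ω) *
            ((((D t).Δ.ρ σ : GL (Fin 2) (padicCoeffIntegers (D t).ι)) :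
                Matrix (Fin 2) (Fin 2) (padicCoeffIntegers (D t).ι)).map
              (fun z : padicCoeffIntegers (D t).ι => algebraMap (padicCoeffField (D t).ι) Ω (z : padicCoeffField (D t).ι))) *
            ((P⁻¹ : GL (Fin 2) Ω) : Matrix (Fin 2) (Fin 2) Ω))
    (hrat : ∀ t : ℕ, Function.Surjective (algebraMap ℤ_[p] (padicCoeffIntegers (D t).ι))) :
    ∃ ρ : FramedGaloisRep ℚ (PowerSeries ℤ_[p]) 2, IsBranchGaloisLattice W p x D ρ := by
  obtain ⟨Mw, hwt⟩ := hwt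
  obtain ⟨Θ, h0, hev, -, hin⟩ := exists_twistCharacter hp2 Mw hx (k := fun t => (D t).k) hwt hmemb
  refine ⟨FramedRep.twist ρ' Θ, isBranchGaloisLattice_of_conjOver W p x D _ Ω ?_ ?_ (fun t => ?_) hrat⟩
  · intro v hv 𝔓 h𝔓 σ hσ
    rw [FramedRep.twist_apply, hin v (not_mem_asIdeal_of_dvd_of_not_dvd hpN hv) 𝔓 h𝔓 σ hσ, map_one, one_mul]
    exact hunr v hv 𝔓 h𝔓 σ hσ
  · obtain ⟨b, P, h⟩ := hfib0
    refine ⟨b, P, fun σ => ?_⟩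
    rw [← h σ, FramedRep.coe_twist_apply]
    apply Matrix.ext
    intro i j
    simp only [Matrix.map_apply, Matrix.smul_apply, smul_eq_mul, map_mul, h0 σ, one_mul]
  · obtain ⟨M, U, P, h⟩ := hfibt t
    have hrem := fun σ : Field.absoluteGaloisGroup ℚ =>
      exists_eq_C_evalHom_add_X_sub_C_mul (((Θ σ : (PowerSeries ℤ_[p])ˣ)) : PowerSeries ℤ_[p]) (hx t)
    choose V hV using hrem
    refine ⟨fun σ => evalHom (x t) (hx t) (((Θ σ : (PowerSeries ℤ_[p])ˣ)) : PowerSeries ℤ_[p]) • M σ,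
      fun σ => V σ • (M σ).map (PowerSeries.C (R := ℤ_[p])) +
        (PowerSeries.C (evalHom (x t) (hx t) (((Θ σ : (PowerSeries ℤ_[p])ˣ)) : PowerSeries ℤ_[p])) +
          (PowerSeries.X - PowerSeries.C (x t)) * V σ) • U σ,
      P, fun σ => ⟨?_, ?_⟩⟩
    · rw [FramedRep.coe_twist_apply, (h σ).1]
      conv_lhs => rw [hV σ]
      apply Matrix.ext
      intro i j
      simp only [Matrix.smul_apply, Matrix.add_apply, Matrix.map_apply, smul_eq_mul, map_mul]
      ring
    · exact twist_member_conj (D t).Δ Ω M _ (fun σ => hev t σ) P (fun σ => (h σ).2) σ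

/-- **`IsBranchGaloisLattice` from an untwisted lattice whose member fibres are given as SPECIALISATIONS at the `ℤ_p`-points `x_t`**
(the print shape of Hida 1986 (2.2c): «the reduction `π mod P_t` is equivalent to `π(f_{P_t})` as a representation into `GL₂(Ω)`»): hypothesis
(U-fib_t) reads `(ρ' σ)(x_t) := (ρ' σ).map (evalHom x_t)` conjugate over `Ω` to Deligne's `(D t).Δ.ρ σ`; the Weierstrass-remainder form is
supplied by `exists_matrix_eq_map_evalHom_add`. [cite: Hida1986, §2 Terminology (p. 558), Thm. 2.1 (2.2b) (2.2c) (p. 559)] -/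
theorem exists_isBranchGaloisLattice_of_untwisted_eval_conjOver (W : WeierstrassCurve ℚ) [W.IsElliptic] [W.IsGloballyMinimal] (hp2 : p ≠ 2)
    (hpN : p ∣ W.conductorNorm ℤ) (x : ℕ → ℤ_[p]) (D : ℕ → Skinner2016.HidaCongruentForm W p 1)
    (hx : ∀ t, ‖x t‖ < 1) (hwt : ∃ M : ℕ, ∀ t, ((p : ℤ_[p]) ^ M) * x t = (((D t).k - 2 : ℤ) : ℤ_[p]))
    (hmemb : ∀ t, 2 * ((p : ℤ) - 1) ∣ (D t).k - 2)
    (Ω : Type*) [Field Ω] [Algebra ℚ_[p] Ω] [∀ t : ℕ, Algebra (padicCoeffField (D t).ι) Ω]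
    [∀ t : ℕ, IsScalarTower ℚ_[p] (padicCoeffField (D t).ι) Ω]
    (ρ' : FramedGaloisRep ℚ (PowerSeries ℤ_[p]) 2)
    (hunr : ∀ v : HeightOneSpectrum (𝓞 ℚ),
      ¬ ((Rat.HeightOneSpectrum.primesEquiv v : Nat.Primes) : ℕ) ∣ W.conductorNorm ℤ → ρ'.IsUnramifiedAt v)
    (hfib0 : ∃ (b : Module.Basis (Fin 2) ℤ_[p] (W.tateModule p)) (P : GL (Fin 2) Ω),
      ∀ σ : Field.absoluteGaloisGroup ℚ,
        (((ρ' σ : GL (Fin 2) (PowerSeries ℤ_[p])) : Matrix (Fin 2) (Fin 2) (PowerSeries ℤ_[p])).map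
            (fun F : PowerSeries ℤ_[p] => algebraMap ℚ_[p] Ω ((PowerSeries.constantCoeff F : ℤ_[p]) : ℚ_[p]))) =
          ((P : GL (Fin 2) Ω) : Matrix (Fin 2) (Fin 2) Ω) *
            (LinearMap.toMatrix b b (W.galoisRepTate p σ)).map (fun z : ℤ_[p] => algebraMap ℚ_[p] Ω (z : ℚ_[p])) *
            ((P⁻¹ : GL (Fin 2) Ω) : Matrix (Fin 2) (Fin 2) Ω))
    (hfibt : ∀ t : ℕ, ∃ P : GL (Fin 2) Ω, ∀ σ : Field.absoluteGaloisGroup ℚ,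
      ((((ρ' σ : GL (Fin 2) (PowerSeries ℤ_[p])) : Matrix (Fin 2) (Fin 2) (PowerSeries ℤ_[p])).map (evalHom (x t) (hx t))).map
          (fun z : ℤ_[p] => algebraMap ℚ_[p] Ω (z : ℚ_[p]))) =
        ((P : GL (Fin 2) Ω) : Matrix (Fin 2) (Fin 2) Ω) *
          ((((D t).Δ.ρ σ : GL (Fin 2) (padicCoeffIntegers (D t).ι)) :
              Matrix (Fin 2) (Fin 2) (padicCoeffIntegers (D t).ι)).map
            (fun z : padicCoeffIntegers (D t).ι => algebraMap (padicCoeffField (D t).ι) Ω (z : padicCoeffField (D t).ι))) *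
          ((P⁻¹ : GL (Fin 2) Ω) : Matrix (Fin 2) (Fin 2) Ω))
    (hrat : ∀ t : ℕ, Function.Surjective (algebraMap ℤ_[p] (padicCoeffIntegers (D t).ι))) :
    ∃ ρ : FramedGaloisRep ℚ (PowerSeries ℤ_[p]) 2, IsBranchGaloisLattice W p x D ρ := by
  refine exists_isBranchGaloisLattice_of_untwisted_conjOver W hp2 hpN x D hx hwt hmemb Ω ρ' hunr hfib0 (fun t => ?_) hrat
  obtain ⟨P, hP⟩ := hfibt t
  have hrem := fun σ : Field.absoluteGaloisGroup ℚ =>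
    exists_matrix_eq_map_evalHom_add (((ρ' σ : GL (Fin 2) (PowerSeries ℤ_[p])) : Matrix (Fin 2) (Fin 2) (PowerSeries ℤ_[p]))) (hx t)
  choose U hU using hrem
  exact ⟨fun σ => (((ρ' σ : GL (Fin 2) (PowerSeries ℤ_[p])) : Matrix (Fin 2) (Fin 2) (PowerSeries ℤ_[p])).map (evalHom (x t) (hx t))),
    U, P, fun σ => ⟨hU σ, hP σ⟩⟩

/-- **The same (specialisation form), with (pts)/(wt)/(memb) read off the analytic chart** `IsPNewBranchAnalyticChart W p ι j A x D` of
T-An-1/T-An-2 (the chart predicate of the SAME `(x, D)` that T-An-2ᵍ packages): an untwisted lattice read over `Ω`, member fibres given as the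
specialisations `(ρ' σ).map (evalHom x_t)` (for every proof `hxt : ‖x_t‖ < 1`, proof-irrelevant), gives `∃ ρ, IsBranchGaloisLattice W p x D ρ` —
the shape a print-verbatim re-typing of T-An-2ᵍ's Galois clause takes. [cite: Hida1986, Thm. 2.1 (2.2b) (2.2c) (p. 559), Cor. 1.3/1.4] -/
theorem exists_isBranchGaloisLattice_of_chart_of_untwisted_conjOver (W : WeierstrassCurve ℚ) [W.IsElliptic] [W.IsGloballyMinimal]
    (hp2 : p ≠ 2) (hpN : p ∣ W.conductorNorm ℤ) {ι : PadicAlgCl p ≃+* ℂ} {j : ℤ_[p] →+* unrIntegers p} {A : ℕ → UnrSeries p}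
    {x : ℕ → ℤ_[p]} {D : ℕ → Skinner2016.HidaCongruentForm W p 1} (hchart : IsPNewBranchAnalyticChart W p ι j A x D)
    (Ω : Type*) [Field Ω] [Algebra ℚ_[p] Ω] [∀ t : ℕ, Algebra (padicCoeffField (D t).ι) Ω]
    [∀ t : ℕ, IsScalarTower ℚ_[p] (padicCoeffField (D t).ι) Ω]
    (ρ' : FramedGaloisRep ℚ (PowerSeries ℤ_[p]) 2)
    (hunr : ∀ v : HeightOneSpectrum (𝓞 ℚ),
      ¬ ((Rat.HeightOneSpectrum.primesEquiv v : Nat.Primes) : ℕ) ∣ W.conductorNorm ℤ → ρ'.IsUnramifiedAt v)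
    (hfib0 : ∃ (b : Module.Basis (Fin 2) ℤ_[p] (W.tateModule p)) (P : GL (Fin 2) Ω),
      ∀ σ : Field.absoluteGaloisGroup ℚ,
        (((ρ' σ : GL (Fin 2) (PowerSeries ℤ_[p])) : Matrix (Fin 2) (Fin 2) (PowerSeries ℤ_[p])).map
            (fun F : PowerSeries ℤ_[p] => algebraMap ℚ_[p] Ω ((PowerSeries.constantCoeff F : ℤ_[p]) : ℚ_[p]))) =
          ((P : GL (Fin 2) Ω) : Matrix (Fin 2) (Fin 2) Ω) *
            (LinearMap.toMatrix b b (W.galoisRepTate p σ)).map (fun z : ℤ_[p] => algebraMap ℚ_[p] Ω (z : ℚ_[p])) *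
            ((P⁻¹ : GL (Fin 2) Ω) : Matrix (Fin 2) (Fin 2) Ω))
    (hfibt : ∀ t : ℕ, ∀ hxt : ‖x t‖ < 1, ∃ P : GL (Fin 2) Ω, ∀ σ : Field.absoluteGaloisGroup ℚ,
      ((((ρ' σ : GL (Fin 2) (PowerSeries ℤ_[p])) : Matrix (Fin 2) (Fin 2) (PowerSeries ℤ_[p])).map (evalHom (x t) hxt)).map
          (fun z : ℤ_[p] => algebraMap ℚ_[p] Ω (z : ℚ_[p]))) =
        ((P : GL (Fin 2) Ω) : Matrix (Fin 2) (Fin 2) Ω) *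
          ((((D t).Δ.ρ σ : GL (Fin 2) (padicCoeffIntegers (D t).ι)) :
              Matrix (Fin 2) (Fin 2) (padicCoeffIntegers (D t).ι)).map
            (fun z : padicCoeffIntegers (D t).ι => algebraMap (padicCoeffField (D t).ι) Ω (z : padicCoeffField (D t).ι))) *
          ((P⁻¹ : GL (Fin 2) Ω) : Matrix (Fin 2) (Fin 2) Ω))
    (hrat : ∀ t : ℕ, Function.Surjective (algebraMap ℤ_[p] (padicCoeffIntegers (D t).ι))) :
    ∃ ρ : FramedGaloisRep ℚ (PowerSeries ℤ_[p]) 2, IsBranchGaloisLattice W p x D ρ :=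
  exists_isBranchGaloisLattice_of_untwisted_eval_conjOver W hp2 hpN x D hchart.norm_lt_one hchart.exists_pow_mul_eq_weight_sub_two
    hchart.dvd_weight_sub_two Ω ρ' hunr hfib0 (fun t => hfibt t (hchart.norm_lt_one t)) hrat

end Summit.BirchSwinnertonDyer.BirchSwinnertonDyer.Theorems.TelescopeBranchLatticeOfUntwisted

end
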